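import Mathlib
import Summits.SmoothPoincare4.SmoothPoincare4.Theses.SullivanDual
import Summits.SmoothPoincare4.SmoothPoincare4.Theorems.SullivanDualHyperbolicEndStubAhlforsOsserman
import Summits.SmoothPoincare4.SmoothPoincare4.Theorems.SullivanDualHyperbolicEndStubSubMeanValueLiouville
import Summits.SmoothPoincare4.SmoothPoincare4.Theorems.SullivanDualHyperbolicEndStubCollarLiouville
import Summits.SmoothPoincare4.SmoothPoincare4.Theorems.SullivanDualHyperbolicEndStubModelPair
import Summits.SmoothPoincare4.SmoothPoincare4.Theorems.SullivanDualHyperbolicEndStandardSphere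
import Literature.Geometry.Symplectic.JHolomorphicMap
import Literature.Geometry.Symplectic.ExactNoJSpheres
import HarnessLib

/-!
# Crux `HyperbolicEnd` (stmt-SmoothPoincare4-7825), line `Sketch` — the crux for homotopy spheres
# diffeomorphic to `S⁴` (consistency of the line's certificate interface)

The line `Sketch` reduces the crux `HyperbolicEnd` to a HYPERBOLIC PAIR `(J, F)` on the punctured
homotopy sphere (an admissible `J` plus a pointwise positive-definite `F` on tangent vectors whose
density along every local `J`-curve into the core satisfies the Ahlfors inequality
`2c λ³ ≤ λ Δλ - |∇λ|²`). Four of its stubs are landed theorems: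
`stub_ahlforsOsserman` (no non-zero `C²` `λ ≥ 0` on `ℂ` with the Ahlfors inequality),
`stub_subMeanValueLiouville` (flat Liouville for sub-mean-value functions), `stub_collarLiouville`
(entire `J`-curves avoiding some collar ball avoid the whole standard collar) and `stub_modelPair`
(the model pair on the ball `B_R ⊂ ℂ²` is a certificate with `c = 2`); and
`hyperbolicPair_of_nonempty_diffeomorph_sphere` builds the hyperbolic pair of every homotopy
`4`-sphere DIFFEOMORPHIC to `S⁴` from the model pair via Palais' chart form.

This file composes them: the clauses of `HyperbolicEnd` hold at every homotopy `4`-sphere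
diffeomorphic to `S⁴` (`hyperbolicEndAt_of_nonempty_diffeomorph_sphere`), hence the smooth
Poincaré conjecture (in the form "every homotopy `4`-sphere is diffeomorphic to `S⁴`") implies the
crux (`hyperbolicEnd_of_forall_nonempty_diffeomorph_sphere`, a registered helper of the line).
So the crux is consistent, its certificate interface is non-vacuous, and — since the crux with
the sibling cruxes of route `SullivanDual` implies SPC4 — `HyperbolicEnd` is SPC4-complete given
those. The composition is the one of the skeleton's `HyperbolicEnd_of`: collar Liouville confines an
entire curve avoiding `B_ε` to the core, its density satisfies the Ahlfors inequality on all of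
`ℂ`, vanishes by Ahlfors–Osserman, so `∂u/∂x ≡ 0`, `du ≡ 0`, and `u` is constant.

References: Ahlfors 1938 (Schwarz lemma); Kobayashi 2001 (almost complex hyperbolicity);
Gromov 1985 §0.3.C (standard ends); Palais 1960 (disc theorem).
-/

noncomputable section

-- the prescribed crux namespace repeats the component `SmoothPoincare4`
set_option linter.dupNamespace false

open scoped Manifold ContDiff Topology
open Laplacian Set
open Literature.Geometry.Symplectic Literature.Topology.FourManifolds

namespace Summit.SmoothPoincare4.SmoothPoincare4.Cruxes.HyperbolicEnd.Sketch

/-- **`HyperbolicEnd` at a homotopy `4`-sphere diffeomorphic to `S⁴`.** For such `Σ` and any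
`p ∈ Σ` there are an admissible `J` on `Σ ∖ p` and a radius `ε'` (closed chart ball in the chart
target, `J² = -1`, `J` smooth, `J` standard on the punctured ball `B_ε'`) such that for
`0 < ε < ε'` no non-constant `C^∞` `J`-holomorphic `u : ℂ → Σ ∖ p` avoids `B_ε`. Proof: take the
hyperbolic pair `(J, F, c)` of the standard sphere (model pair pulled back by Palais' chart-form
diffeomorphism `Σ ∖ p ≃ ℝ⁴`); an entire curve avoiding `B_ε` avoids `B_ε'`
(`stub_collarLiouville` with `stub_subMeanValueLiouville`), so its density `λ = F(u, ∂ₓu)` is `C²`,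
`≥ 0` and satisfies the Ahlfors inequality on `ℂ`, hence `λ ≡ 0` (`stub_ahlforsOsserman`),
`∂ₓu ≡ 0`, `du ≡ 0` (`mfderiv_eq_zero_of_apply_one_eq_zero`), `u` constant
(`apply_eq_apply_zero_of_mfderiv_eq_zero`) — contradiction. -/
theorem hyperbolicEndAt_of_nonempty_diffeomorph_sphere (S : HomotopySphere 4) (p : S.carrier)
    (hS : Nonempty (S.carrier ≃ₘ⟮𝓡 4, 𝓡 4⟯ Metric.sphere (0 : EuclideanSpace ℝ (Fin 5)) 1)) :
    ∃ (J : ∀ x : ↥(punctured p), TangentSpace (𝓡 4) x →L[ℝ] TangentSpace (𝓡 4) x) (ε' : ℝ),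
      0 < ε' ∧ Metric.closedBall (extChartAt (𝓡 4) p p) ε' ⊆ (extChartAt (𝓡 4) p).target ∧
      (∀ (x : ↥(punctured p)) (v : TangentSpace (𝓡 4) x), J x (J x v) = -v) ∧
      (∀ x₀ : ↥(punctured p), ContMDiffAt (𝓡 4)
        𝓘(ℝ, EuclideanSpace ℝ (Fin 4) →L[ℝ] EuclideanSpace ℝ (Fin 4)) ∞
        (inTangentCoordinates (𝓡 4) (𝓡 4) (id : ↥(punctured p) → ↥(punctured p)) id
          (fun x => J x) x₀) x₀) ∧
      (∀ x : ↥(punctured p), InPuncturedChartBall p ε' x →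
        ∀ (v : TangentSpace (𝓡 4) x) (b : EuclideanSpace ℝ (Fin 4)),
          inner ℝ (fderiv ℝ inversion (extChartAt (𝓡 4) p x.1 - extChartAt (𝓡 4) p p)
            (mfderiv (𝓡 4) 𝓘(ℝ, EuclideanSpace ℝ (Fin 4))
              (fun z : ↥(punctured p) => extChartAt (𝓡 4) p z.1) x (J x v))) b =
          stdSymplecticForm (fderiv ℝ inversion (extChartAt (𝓡 4) p x.1 - extChartAt (𝓡 4) p p)
            (mfderiv (𝓡 4) 𝓘(ℝ, EuclideanSpace ℝ (Fin 4))
              (fun z : ↥(punctured p) => extChartAt (𝓡 4) p z.1) x v)) b) ∧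
      ∀ ε : ℝ, 0 < ε → ε < ε' → ¬ ∃ u : ℂ → ↥(punctured p),
        (ContMDiff 𝓘(ℝ, ℂ) (𝓡 4) ∞ u ∧ (∃ z z' : ℂ, u z ≠ u z') ∧
          (∀ z ζ : ℂ, mfderiv 𝓘(ℝ, ℂ) (𝓡 4) u z (Complex.I * ζ : ℂ) =
            J (u z) (mfderiv 𝓘(ℝ, ℂ) (𝓡 4) u z (ζ : ℂ))) ∧
          (∀ z : ℂ, ¬ InPuncturedChartBall p ε (u z))) := by
  obtain ⟨J, ε', c, F, hε', hball, hJ2, hJs, hJstd, hc, hF, hcurv⟩ :=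
    hyperbolicPair_of_nonempty_diffeomorph_sphere stub_modelPair S p hS
  refine ⟨J, ε', hε', hball, hJ2, hJs, hJstd, ?_⟩
  intro ε hε _hεε'
  rintro ⟨u, hu, hne, hhol, havoid⟩
  -- the curve avoids the larger ball (collar Liouville with `η = ε`)
  have havoid' : ∀ z, ¬ InPuncturedChartBall p ε' (u z) :=
    stub_collarLiouville stub_subMeanValueLiouville S p J ε' hε' hball hJstd u hu hne hhol
      ⟨ε, hε, havoid⟩
  -- its density satisfies the Ahlfors inequality on all of `ℂ`
  obtain ⟨hlam2, hineq⟩ := hcurv Set.univ u isOpen_univ hu.contMDiffOn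
    (fun z _ ζ => hhol z ζ) (fun z _ => havoid' z)
  set lam : ℂ → ℝ := fun z => F (u z) (mfderiv 𝓘(ℝ, ℂ) (𝓡 4) u z (1 : ℂ)) with hlam_def
  have hlamC : ContDiff ℝ 2 lam := contDiffOn_univ.1 hlam2
  have hlam0 : ∀ z, 0 ≤ lam z := fun z => (hF (u z) (havoid' z) _).1
  have hzero : ∀ z, lam z = 0 :=
    stub_ahlforsOsserman c lam hc hlamC hlam0 (fun z => hineq z (Set.mem_univ z))
  -- hence `∂u/∂x ≡ 0`, `du ≡ 0`, and `u` is constant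
  have hdx : ∀ z, mfderiv 𝓘(ℝ, ℂ) (𝓡 4) u z (1 : ℂ) = 0 := fun z =>
    (hF (u z) (havoid' z) _).2 (hzero z)
  have hd : ∀ z, mfderiv 𝓘(ℝ, ℂ) (𝓡 4) u z = 0 := fun z =>
    mfderiv_eq_zero_of_apply_one_eq_zero hhol (hdx z)
  obtain ⟨z, z', hzz'⟩ := hne
  exact hzz' ((apply_eq_apply_zero_of_mfderiv_eq_zero (hu.of_le (by norm_num)) hd z).trans
    (apply_eq_apply_zero_of_mfderiv_eq_zero (hu.of_le (by norm_num)) hd z').symm)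

/-- **SPC4 ⇒ `HyperbolicEnd`** (registered helper of the line): if every homotopy `4`-sphere is
diffeomorphic to `S⁴`, the crux holds — pointwise `hyperbolicEndAt_of_nonempty_diffeomorph_sphere`.
In particular the crux is consistent (true for `S⁴` itself) and, being implied by SPC4, cannot be
refuted short of an exotic `4`-sphere. -/
theorem hyperbolicEnd_of_forall_nonempty_diffeomorph_sphere :
    (∀ S : HomotopySphere 4,
      Nonempty (S.carrier ≃ₘ⟮𝓡 4, 𝓡 4⟯ Metric.sphere (0 : EuclideanSpace ℝ (Fin 5)) 1)) →
    Summit.SmoothPoincare4.SmoothPoincare4.Theses.SullivanDual.HyperbolicEnd :=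
  fun h S p => hyperbolicEndAt_of_nonempty_diffeomorph_sphere S p (h S)

end Summit.SmoothPoincare4.SmoothPoincare4.Cruxes.HyperbolicEnd.Sketch

end
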